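import Summits.ABC.StewartYu.ArchG3Schedule
import HarnessLib

/-!
# Cell abc-stewartyu, rung A1.L (crux r2 `ArchCoreRat`), WP-L.A: the level schedule WITH A GENERIC EXTRA INVARIANT `Q` (ruling R32 (c1)) —
# the last-level STATE exported before the `FrameOutputTwo` projection

`Summits/ABC/StewartYu/ArchG3ScheduleQ.lean` — cell `abc-stewartyu` (HOME `run/shared/lean/pub/abc-stewartyu/`; plan ruling R32 (c) amended
2026-08-27 17:24:45Z «THE ξ-END SEAM»; seat lp-1 g8).  One definition (`ArchLevelStateQ`) and theorems on `ArchG3Setup`; no named fact, no numerics.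
Sequel of `ArchG3Schedule` (✓): the SAME induction over the levels, threading an arbitrary predicate
`Q : Finset ι → (ι → Fin n → ℤ) → ℕ → Prop` on (family, relative exponents, level) that the record / the END may choose — e.g. the
VIRTUAL interval box of the exponents in the coordinates `ν` of a saturated basis (one-stage line at `S(θ)`, R32 (a)), which the ξ-END
(`ArchG3XiOutput`, seat p4) needs at the last level and which the θ-box `Lb s Ŝ` does not give.

* `ArchLevelStateQ Q …` = `ArchLevelState …` ∧ `Q B v lev` for the SAME witnesses `(B, v)`; `ArchLevelStateQ.toState`, `archLevelStateQ_of_inv`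
  (the constructor the START uses: level-`0` invariant + `Q B v 0`).
* PROPAGATION: the k-steps keep `(B, v)` (`ArchLvInv.kchain` / `levelRun`), so `Q` is untouched inside a level; the half-step sends
  `(B, v) ↦ (parityClass v B i₀, halfDiff v i₀)` for SOME pivot `i₀ ∈ B`, so the one hypothesis is
  `hQhalf : ∀ lev B v i₀, i₀ ∈ B → Q B v lev → Q (parityClass v B i₀) (halfDiff v i₀) (lev + 1)`.
* `levelZeroRunQ`, `levelUpQ`, `levelsQ`, **`lastLevelState_of_schedule`** (START state with `Q` at `(0,0)` + all record packages ⇒ the state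
  at `(Ŝ, n)` with `Q`), and the projection `frameOutput_of_scheduleQ` (= `frameOutput_of_schedule` through `toState`).

WHAT THIS IS NOT: no change to `ArchG3Schedule`'s statements; no choice of `Q`; no crux moves.

References: Yu. V. Nesterenko, LNM 1819 (2003) §4 Prop. 4.1, §4.3 (4.46)–(4.50), §5.1, p. 80–97 [Nesterenko2003]; K. Yu, Acta Math. 211
(2013) §5.1 (the END in ξ = α^{1/N}) [Yu2013].
-/

noncomputable section

open Finset Polynomial
open Literature.NumberTheory.Transcendental
open Literature.NumberTheory.Transcendental.CW77.Setup (Tau)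
open Summit.ABC.StewartYu.FeldmanBasis (feldR)
open Summit.ABC.StewartYu.ArchSupply (scaledFeldR hasse_scaledFeldR_eval)

namespace Summit.ABC.StewartYu

namespace ArchG3Setup

variable (S : ArchG3Setup)

/-- **The state at level `lev` with the extra invariant `Q`**: the witnesses `(B, v, lo, γ)` of `ArchLevelState` together with `Q B v lev`.
[cite: Nesterenko2003, §4 (4.6)/(4.27) (the statement A(N,T;X) per level), p. 80–87; shape only] -/
def ArchLevelStateQ (Q : Finset (ℕ × (Fin S.n → ℤ)) → ((ℕ × (Fin S.n → ℤ)) → Fin S.n → ℤ) → ℕ → Prop) (H Sh : ℕ) (s : Fin S.n → ℕ)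
    (U : Finset (ℕ × (Fin S.n → ℤ))) (pv : ℕ × (Fin S.n → ℤ) → ℤ) (P : ℤ) (wl γb : ℕ → ℝ) (cl : ℕ → ℤ) (el : ℕ → Fin S.n → ℤ)
    (lev N T : ℕ) : Prop :=
  ∃ (B : Finset (ℕ × (Fin S.n → ℤ))) (v : ℕ × (Fin S.n → ℤ) → Fin S.n → ℤ) (lo : Fin S.n → ℤ) (γ : ℝ),
    B ⊆ U ∧ (∀ i ∈ B, ∀ i' ∈ B, v i = v i' ↔ i.2 = i'.2) ∧ |γ| ≤ γb lev ∧
    S.ArchLvInv (fun i => scaledFeldR i.1 H (Sh - lev)) B v pv lo (S.Lb s lev) P (wl lev) γ (cl lev) (el lev) {x : ℤ | |x| ≤ (N : ℤ)} T ∧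
    Q B v lev

variable {S}

/-- Dropping `Q`. [folklore] -/
theorem ArchLevelStateQ.toState {Q : Finset (ℕ × (Fin S.n → ℤ)) → ((ℕ × (Fin S.n → ℤ)) → Fin S.n → ℤ) → ℕ → Prop} {H Sh : ℕ}
    {s : Fin S.n → ℕ} {U : Finset (ℕ × (Fin S.n → ℤ))} {pv : ℕ × (Fin S.n → ℤ) → ℤ} {P : ℤ} {wl γb : ℕ → ℝ} {cl : ℕ → ℤ}
    {el : ℕ → Fin S.n → ℤ} {lev N T : ℕ} (h : S.ArchLevelStateQ Q H Sh s U pv P wl γb cl el lev N T) :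
    S.ArchLevelState H Sh s U pv P wl γb cl el lev N T := by
  obtain ⟨B, v, lo, γ, hBU, hinj, hγ, h, _⟩ := h
  exact ⟨B, v, lo, γ, hBU, hinj, hγ, h⟩

/-- **The constructor the START uses**: a level-`lev` invariant on `B ⊆ U` with exponents injective in `λ`, `|γ| ≤ γb lev` and `Q B v lev`
give the state with `Q`. [folklore] -/
theorem archLevelStateQ_of_inv {Q : Finset (ℕ × (Fin S.n → ℤ)) → ((ℕ × (Fin S.n → ℤ)) → Fin S.n → ℤ) → ℕ → Prop} {H Sh : ℕ}
    {s : Fin S.n → ℕ} {U B : Finset (ℕ × (Fin S.n → ℤ))} {v : ℕ × (Fin S.n → ℤ) → Fin S.n → ℤ} {pv : ℕ × (Fin S.n → ℤ) → ℤ}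
    {lo : Fin S.n → ℤ} {P : ℤ} {wl γb : ℕ → ℝ} {γ : ℝ} {cl : ℕ → ℤ} {el : ℕ → Fin S.n → ℤ} {lev N T : ℕ} (hBU : B ⊆ U)
    (hinj : ∀ i ∈ B, ∀ i' ∈ B, v i = v i' ↔ i.2 = i'.2) (hγ : |γ| ≤ γb lev)
    (h : S.ArchLvInv (fun i => scaledFeldR i.1 H (Sh - lev)) B v pv lo (S.Lb s lev) P (wl lev) γ (cl lev) (el lev)
      {x : ℤ | |x| ≤ (N : ℤ)} T) (hQ : Q B v lev) :
    S.ArchLevelStateQ Q H Sh s U pv P wl γb cl el lev N T :=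
  ⟨B, v, lo, γ, hBU, hinj, hγ, h, hQ⟩

/-- **The k-steps of level `0` with `Q`** (`(B, v)` unchanged). [cite: Nesterenko2003, §4.2 (the sets 𝒳_{0,ν}), p. 87–88] -/
theorem levelZeroRunQ {Q : Finset (ℕ × (Fin S.n → ℤ)) → ((ℕ × (Fin S.n → ℤ)) → Fin S.n → ℤ) → ℕ → Prop} {H Sh : ℕ}
    {s : Fin S.n → ℕ} {U : Finset (ℕ × (Fin S.n → ℤ))} {pv : ℕ × (Fin S.n → ℤ) → ℤ} {P : ℤ} {δ₀ : ℝ}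
    {wl γb : ℕ → ℝ} {cl : ℕ → ℤ} {el : ℕ → Fin S.n → ℤ} (hΛ : |S.Λ / (S.b S.j₀ : ℝ)| ≤ δ₀) (N T : ℕ → ℕ → ℕ)
    (hK0 : ∀ ν, ν < S.n → S.ArchKStepHypU (fun i => scaledFeldR i.1 H (Sh - 0)) U (S.Lb s 0) P (wl 0) (γb 0) (cl 0) (el 0) δ₀
      (N 0 ν) (N 0 (ν + 1)) (T 0 ν) (T 0 (ν + 1)))
    (h00 : S.ArchLevelStateQ Q H Sh s U pv P wl γb cl el 0 (N 0 0) (T 0 0)) :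
    S.ArchLevelStateQ Q H Sh s U pv P wl γb cl el 0 (N 0 S.n) (T 0 S.n) := by
  obtain ⟨B, v, lo, γ, hBU, hinj, hγ, h, hQ⟩ := h00
  have h1 := ArchLvInv.kchain hBU hΛ hγ (N 0) (T 0) 0 S.n (fun ν _ h1 => hK0 ν (by omega)) (by simpa using h)
  exact ⟨B, v, lo, γ, hBU, hinj, hγ, by simpa using h1, hQ⟩

/-- **One level up with `Q`**: half-step (`(B, v) ↦ (parityClass v B i₀, halfDiff v i₀)`, so `Q` moves by `hQhalf`) + odd-node k-step +
`n − 1` k-steps (`(B, v)` unchanged). [cite: Nesterenko2003, §4 Prop. 4.1, §4.2–4.3, p. 80–95] -/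
theorem levelUpQ {Q : Finset (ℕ × (Fin S.n → ℤ)) → ((ℕ × (Fin S.n → ℤ)) → Fin S.n → ℤ) → ℕ → Prop} {H Sh : ℕ}
    {s : Fin S.n → ℕ} {U : Finset (ℕ × (Fin S.n → ℤ))} {pv : ℕ × (Fin S.n → ℤ) → ℤ} {P : ℤ} {δ₀ : ℝ}
    {wl γb : ℕ → ℝ} {cl : ℕ → ℤ} {el : ℕ → Fin S.n → ℤ} (hn : 1 ≤ S.n)
    (hind : ∀ T₁ : Finset (Fin S.n), T₁.Nonempty → ¬ IsSquare (∏ j ∈ T₁, S.α j)) (hΛ : |S.Λ / (S.b S.j₀ : ℝ)| ≤ δ₀)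
    (hQhalf : ∀ (lev : ℕ) (B : Finset (ℕ × (Fin S.n → ℤ))) (v : ℕ × (Fin S.n → ℤ) → Fin S.n → ℤ) (i₀ : ℕ × (Fin S.n → ℤ)),
      i₀ ∈ B → Q B v lev → Q (S.parityClass v B i₀) (S.halfDiff v i₀) (lev + 1))
    (N T : ℕ → ℕ → ℕ) (Nh : ℕ → ℕ) (lev : ℕ) (hwl : wl (lev + 1) = wl lev / 2) (hγb : wl lev / 2 ≤ γb (lev + 1))
    (hH : S.ArchHalfStepHypU (fun i => scaledFeldR i.1 H (Sh - lev)) (fun i => scaledFeldR i.1 H (Sh - (lev + 1))) U (S.Lb s lev) P (wl lev)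
      (γb lev) (cl lev) (el lev) (cl (lev + 1)) δ₀ (N lev S.n) (Nh (lev + 1)) (T lev S.n) (T (lev + 1) 0))
    (hO : S.ArchKStepOddHypU (fun i => scaledFeldR i.1 H (Sh - (lev + 1))) U (S.Lb s (lev + 1)) P (wl (lev + 1)) (γb (lev + 1))
      (cl (lev + 1)) (el (lev + 1)) δ₀ (Nh (lev + 1)) (N (lev + 1) 1) (T (lev + 1) 0) (T (lev + 1) 1))
    (hK : ∀ ν, 1 ≤ ν → ν < S.n → S.ArchKStepHypU (fun i => scaledFeldR i.1 H (Sh - (lev + 1))) U (S.Lb s (lev + 1)) P (wl (lev + 1))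
      (γb (lev + 1)) (cl (lev + 1)) (el (lev + 1)) δ₀ (N (lev + 1) ν) (N (lev + 1) (ν + 1)) (T (lev + 1) ν) (T (lev + 1) (ν + 1)))
    (hst : S.ArchLevelStateQ Q H Sh s U pv P wl γb cl el lev (N lev S.n) (T lev S.n)) :
    S.ArchLevelStateQ Q H Sh s U pv P wl γb cl el (lev + 1) (N (lev + 1) S.n) (T (lev + 1) S.n) := by
  classical
  obtain ⟨B, v, lo, γ, hBU, hinj, hγ, h, hQ⟩ := hst
  obtain ⟨i₀, hi₀B, _, h1⟩ := ArchLvInv.halfStep_of_hypU hBU h hind hΛ hγ hH (el (lev + 1))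
  have hB'U : S.parityClass v B i₀ ⊆ U := (S.parityClass_subset v B i₀).trans hBU
  have hγ' : |(γ - S.Lsum (v i₀)) / 2| ≤ γb (lev + 1) := (S.abs_half_center_le v (h.slab i₀ hi₀B)).trans hγb
  have h1' : S.ArchLvInv (fun i => scaledFeldR i.1 H (Sh - (lev + 1))) (S.parityClass v B i₀) (S.halfDiff v i₀) pv
      (fun j => -((v i₀ j - lo j) / 2)) (S.Lb s (lev + 1)) P (wl (lev + 1)) ((γ - S.Lsum (v i₀)) / 2) (cl (lev + 1)) (el (lev + 1))
      {x : ℤ | Odd x ∧ |x| ≤ 2 * (Nh (lev + 1) : ℤ) - 1} (T (lev + 1) 0) := by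
    rw [hwl]; exact h1
  have h2 := ArchLvInv.levelRun hB'U hΛ hγ' (N (lev + 1)) (T (lev + 1)) (S.n - 1) hO (fun ν h0 h1 => hK ν h0 (by omega)) h1'
  rw [show 1 + (S.n - 1) = S.n by omega] at h2
  refine ⟨S.parityClass v B i₀, S.halfDiff v i₀, _, _, hB'U, ?_, hγ', h2, hQhalf lev B v i₀ hi₀B hQ⟩
  -- injectivity of the new exponents in `λ` (as in `levelUp`)
  intro i hi i' hi'
  have hiB : i ∈ B := S.parityClass_subset v B i₀ hi
  have hi'B : i' ∈ B := S.parityClass_subset v B i₀ hi'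
  have hpar : ∀ j, 2 ∣ v i j - v i₀ j := ((S.mem_parityClass v).mp hi).2
  have hpar' : ∀ j, 2 ∣ v i' j - v i₀ j := ((S.mem_parityClass v).mp hi').2
  rw [← hinj i hiB i' hi'B]
  constructor
  · intro hw
    rw [S.eq_add_two_smul_halfDiff v hpar, S.eq_add_two_smul_halfDiff v hpar', hw]
  · intro hv
    funext j; simp only [halfDiff, hv]

/-- **All the levels with `Q`**. [cite: Nesterenko2003, §4 Prop. 4.1, p. 80–81] -/
theorem levelsQ {Q : Finset (ℕ × (Fin S.n → ℤ)) → ((ℕ × (Fin S.n → ℤ)) → Fin S.n → ℤ) → ℕ → Prop} {H Sh : ℕ}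
    {s : Fin S.n → ℕ} {U : Finset (ℕ × (Fin S.n → ℤ))} {pv : ℕ × (Fin S.n → ℤ) → ℤ} {P : ℤ} {δ₀ : ℝ}
    {wl γb : ℕ → ℝ} {cl : ℕ → ℤ} {el : ℕ → Fin S.n → ℤ} (hn : 1 ≤ S.n)
    (hind : ∀ T₁ : Finset (Fin S.n), T₁.Nonempty → ¬ IsSquare (∏ j ∈ T₁, S.α j)) (hΛ : |S.Λ / (S.b S.j₀ : ℝ)| ≤ δ₀)
    (hQhalf : ∀ (lev : ℕ) (B : Finset (ℕ × (Fin S.n → ℤ))) (v : ℕ × (Fin S.n → ℤ) → Fin S.n → ℤ) (i₀ : ℕ × (Fin S.n → ℤ)),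
      i₀ ∈ B → Q B v lev → Q (S.parityClass v B i₀) (S.halfDiff v i₀) (lev + 1))
    (N T : ℕ → ℕ → ℕ) (Nh : ℕ → ℕ) (hwl : ∀ lev, wl (lev + 1) = wl lev / 2) (hγb : ∀ lev, wl lev / 2 ≤ γb (lev + 1))
    (hH : ∀ lev < Sh, S.ArchHalfStepHypU (fun i => scaledFeldR i.1 H (Sh - lev)) (fun i => scaledFeldR i.1 H (Sh - (lev + 1))) U (S.Lb s lev) P
      (wl lev) (γb lev) (cl lev) (el lev) (cl (lev + 1)) δ₀ (N lev S.n) (Nh (lev + 1)) (T lev S.n) (T (lev + 1) 0))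
    (hO : ∀ lev < Sh, S.ArchKStepOddHypU (fun i => scaledFeldR i.1 H (Sh - (lev + 1))) U (S.Lb s (lev + 1)) P (wl (lev + 1)) (γb (lev + 1))
      (cl (lev + 1)) (el (lev + 1)) δ₀ (Nh (lev + 1)) (N (lev + 1) 1) (T (lev + 1) 0) (T (lev + 1) 1))
    (hK : ∀ lev < Sh, ∀ ν, 1 ≤ ν → ν < S.n → S.ArchKStepHypU (fun i => scaledFeldR i.1 H (Sh - (lev + 1))) U (S.Lb s (lev + 1)) P
      (wl (lev + 1)) (γb (lev + 1)) (cl (lev + 1)) (el (lev + 1)) δ₀ (N (lev + 1) ν) (N (lev + 1) (ν + 1)) (T (lev + 1) ν) (T (lev + 1) (ν + 1)))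
    (h0 : S.ArchLevelStateQ Q H Sh s U pv P wl γb cl el 0 (N 0 S.n) (T 0 S.n)) :
    ∀ lev ≤ Sh, S.ArchLevelStateQ Q H Sh s U pv P wl γb cl el lev (N lev S.n) (T lev S.n) := by
  intro lev
  induction lev with
  | zero => intro _; exact h0
  | succ lev ih =>
    intro hle
    exact levelUpQ hn hind hΛ hQhalf N T Nh lev (hwl lev) (hγb lev) (hH lev (by omega)) (hO lev (by omega)) (hK lev (by omega))
      (ih (by omega))

/-- **THE LAST-LEVEL STATE OF THE ARCHIMEDEAN FRAME WITH `Q`** (R32 (c1); the content of `stub_levelsArch` in the one-stage line): the START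
state with `Q` at `(0,0)`, all record packages, independent square classes and `|Λ/b_{j₀}| ≤ δ₀` give, at the last level `Ŝ`, a family
`B ⊆ U` with exponents injective in `λ`, a centre `|γ| ≤ γb Ŝ`, the Δ-invariant for the weights `Δ(Y₀; ℓ₀, H)` on `|x| ≤ N Ŝ n` to the order
`T Ŝ n`, AND `Q B v Ŝ` — exported BEFORE the `FrameOutputTwo` projection, for an END in other coordinates (ξ = α^{1/N}).
[cite: Nesterenko2003, §4 Prop. 4.1, §4.3 (4.46)–(4.50), p. 80–95] [cite: Yu2013, §5.1; shape only] -/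
theorem lastLevelState_of_schedule {Q : Finset (ℕ × (Fin S.n → ℤ)) → ((ℕ × (Fin S.n → ℤ)) → Fin S.n → ℤ) → ℕ → Prop} {H Sh : ℕ}
    {s : Fin S.n → ℕ} {U : Finset (ℕ × (Fin S.n → ℤ))} {pv : ℕ × (Fin S.n → ℤ) → ℤ} {P : ℤ} {δ₀ : ℝ}
    {wl γb : ℕ → ℝ} {cl : ℕ → ℤ} {el : ℕ → Fin S.n → ℤ} (hn : 1 ≤ S.n)
    (hind : ∀ T₁ : Finset (Fin S.n), T₁.Nonempty → ¬ IsSquare (∏ j ∈ T₁, S.α j)) (hΛ : |S.Λ / (S.b S.j₀ : ℝ)| ≤ δ₀)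
    (hQhalf : ∀ (lev : ℕ) (B : Finset (ℕ × (Fin S.n → ℤ))) (v : ℕ × (Fin S.n → ℤ) → Fin S.n → ℤ) (i₀ : ℕ × (Fin S.n → ℤ)),
      i₀ ∈ B → Q B v lev → Q (S.parityClass v B i₀) (S.halfDiff v i₀) (lev + 1))
    (N T : ℕ → ℕ → ℕ) (Nh : ℕ → ℕ) (hwl : ∀ lev, wl (lev + 1) = wl lev / 2) (hγb : ∀ lev, wl lev / 2 ≤ γb (lev + 1))
    (hK0 : ∀ ν, ν < S.n → S.ArchKStepHypU (fun i => scaledFeldR i.1 H (Sh - 0)) U (S.Lb s 0) P (wl 0) (γb 0) (cl 0) (el 0) δ₀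
      (N 0 ν) (N 0 (ν + 1)) (T 0 ν) (T 0 (ν + 1)))
    (hH : ∀ lev < Sh, S.ArchHalfStepHypU (fun i => scaledFeldR i.1 H (Sh - lev)) (fun i => scaledFeldR i.1 H (Sh - (lev + 1))) U (S.Lb s lev) P
      (wl lev) (γb lev) (cl lev) (el lev) (cl (lev + 1)) δ₀ (N lev S.n) (Nh (lev + 1)) (T lev S.n) (T (lev + 1) 0))
    (hO : ∀ lev < Sh, S.ArchKStepOddHypU (fun i => scaledFeldR i.1 H (Sh - (lev + 1))) U (S.Lb s (lev + 1)) P (wl (lev + 1)) (γb (lev + 1))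
      (cl (lev + 1)) (el (lev + 1)) δ₀ (Nh (lev + 1)) (N (lev + 1) 1) (T (lev + 1) 0) (T (lev + 1) 1))
    (hK : ∀ lev < Sh, ∀ ν, 1 ≤ ν → ν < S.n → S.ArchKStepHypU (fun i => scaledFeldR i.1 H (Sh - (lev + 1))) U (S.Lb s (lev + 1)) P
      (wl (lev + 1)) (γb (lev + 1)) (cl (lev + 1)) (el (lev + 1)) δ₀ (N (lev + 1) ν) (N (lev + 1) (ν + 1)) (T (lev + 1) ν) (T (lev + 1) (ν + 1)))
    (h00 : S.ArchLevelStateQ Q H Sh s U pv P wl γb cl el 0 (N 0 0) (T 0 0)) :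
    S.ArchLevelStateQ Q H Sh s U pv P wl γb cl el Sh (N Sh S.n) (T Sh S.n) :=
  levelsQ hn hind hΛ hQhalf N T Nh hwl hγb hH hO hK (levelZeroRunQ hΛ N T hK0 h00) Sh le_rfl

/-- **The last-level invariant with the plain weights `Δ(Y₀; ℓ₀, H)`** (`scaledFeldR ℓ₀ H (Ŝ − Ŝ) = feldR ℓ₀ H` up to `congr_R`), the form the
END consumes. [cite: Nesterenko2003, §5.1 (5.1)–(5.4), p. 95–97] -/
theorem lastLevelInv_feldR {Q : Finset (ℕ × (Fin S.n → ℤ)) → ((ℕ × (Fin S.n → ℤ)) → Fin S.n → ℤ) → ℕ → Prop} {H Sh : ℕ}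
    {s : Fin S.n → ℕ} {U : Finset (ℕ × (Fin S.n → ℤ))} {pv : ℕ × (Fin S.n → ℤ) → ℤ} {P : ℤ} {wl γb : ℕ → ℝ} {cl : ℕ → ℤ}
    {el : ℕ → Fin S.n → ℤ} {N T : ℕ} (hst : S.ArchLevelStateQ Q H Sh s U pv P wl γb cl el Sh N T) :
    ∃ (B : Finset (ℕ × (Fin S.n → ℤ))) (v : ℕ × (Fin S.n → ℤ) → Fin S.n → ℤ) (lo : Fin S.n → ℤ) (γ : ℝ),
      B ⊆ U ∧ (∀ i ∈ B, ∀ i' ∈ B, v i = v i' ↔ i.2 = i'.2) ∧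
      S.ArchLvInv (fun i => feldR i.1 H) B v pv lo (S.Lb s Sh) P (wl Sh) γ (cl Sh) (el Sh) {x : ℤ | |x| ≤ (N : ℤ)} T ∧ Q B v Sh := by
  classical
  obtain ⟨B, v, lo, γ, hBU, hinj, _, h, hQ⟩ := hst
  refine ⟨B, v, lo, γ, hBU, hinj, h.congr_R fun i _ t x => ?_, hQ⟩
  rw [Nat.sub_self, hasse_scaledFeldR_eval]
  simp

/-- The projection to the place-free frame output (= `frameOutput_of_schedule` through `toState`). [cite: Nesterenko2003, §5.1, p. 95–97] -/
theorem frameOutput_of_scheduleQ {Q : Finset (ℕ × (Fin S.n → ℤ)) → ((ℕ × (Fin S.n → ℤ)) → Fin S.n → ℤ) → ℕ → Prop} {H Sh D₀ : ℕ}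
    {s : Fin S.n → ℕ} {U : Finset (ℕ × (Fin S.n → ℤ))} {pv : ℕ × (Fin S.n → ℤ) → ℤ} {P : ℤ} {wl γb : ℕ → ℝ} {cl : ℕ → ℤ}
    {el : ℕ → Fin S.n → ℤ} {N T X' S₀ : ℕ} (hst : S.ArchLevelStateQ Q H Sh s U pv P wl γb cl el Sh N T) (hU : ∀ i ∈ U, i.1 ≤ D₀)
    (hX : (S.n + 1) * X' ≤ N) (hS : (S.n + 1) * S₀ < T) :
    GenThreeFrameSpecTwo.FrameOutputTwo S.n S.α S.b S.j₀ D₀ S₀ X' (S.Lb s Sh) :=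
  frameOutput_of_levelState hst.toState hU hX hS

end ArchG3Setup

end Summit.ABC.StewartYu

end
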